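import Literature.Probability.RandomPlanarGeometry.SAWPulledBridgeGain
import Literature.Probability.RandomPlanarGeometry.SAWPulledFreeEnergyZ2
import Mathlib.Analysis.Subadditive
import HarnessLib

/-!
# The pulled-bridge free energy `λ_B(y) = lim N⁻¹ log Z^B_N(y)` exists (Fekete); X26/X27 as statements about `λ_B`

Topic `Literature/Probability/RandomPlanarGeometry` (sits on top of `SAWPulledBridgeGain.lean` (X27 «PULL-GAIN»:
`Zd.pulledBridgeZ_mul_le`, `Zd.pulledBridgeZ_geometric_lower`) and `SAWPulledFreeEnergyZ2.lean` (X26 «PULL-ENCL»: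
`SAW.pulledBridgeZ_two_lower`, `SAW.driftZ_two_upper`, `Zd.pulledBridgeZ_le_driftZ`)).
Sources. Fekete's lemma (Madras–Slade Lemma 1.2.2 = Mathlib `Subadditive.tendsto_lim`) applied to `-log Z^B_N(y)`,
subadditive by bridge concatenation (`Zd.pulledBridgeZ_mul_le`, [cite: Beaton2015, §3 (p.4: "B(x,y) … bridges can be
concatenated")]; Janse van Rensburg (2009, cite-level, not held as a bib entry) and [cite: Beaton2015, §2 (p.3 L19–L21)] state the existence of the pulled free
energy for half-space walks; for BRIDGES it is the one-line Fekete argument formalised here (every `d`, every `y > 0`).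

## Contents (namespace `Literature.Probability.RandomPlanarGeometry.SAW.Zd`; all PROVED; one def)

* `count_le_count_one_pow` (`c_N ≤ c_1^N`), `pulledBridgeZ_le_pow` (`Z^B_N(y) ≤ (c_1 max(1,y))^N`);
* **`exists_tendsto_log_pulledBridgeZ_div`** — for `y > 0`: `∃ λ, N⁻¹ log Z^B_N(y) → λ ∧ ∀ N ≥ 1, N⁻¹ log Z^B_N(y) ≤ λ`;
* `pulledBridgeFreeEnergy d y` (def, the limit) with `tendsto_pulledBridgeFreeEnergy`, `log_div_le_pulledBridgeFreeEnergy`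
  (`λ_B = sup`), `log_le_pulledBridgeFreeEnergy_of_geometric` / `pulledBridgeFreeEnergy_le_log_of_geometric` (transfer of
  geometric finite-`N` bounds to `λ_B`);
* **`log_connectiveConstant_add_exp_le_pulledBridgeFreeEnergy`** — X27 as printed-style free-energy statement:
  `λ_B(y) ≥ log(μ + e^{-2/(y-1)})` for every `y > 1`, every `d`;
* **`pulledBridgeFreeEnergy_two_two_mem`** — X26 (K1 edition) as a free-energy statement on `ℤ²`:
  `log(1250/351) ≤ λ_B(2) ≤ log(7206013/2000000)`, i.e. `e^{λ_B(2)} ∈ [3.5612…, 3.6030065]`.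

Provenance: lane «pcv-sawmu», typed and proved by a-idea-1 gen 7 (2026-08-22T07:07:27Z), filed by a-p6; 0 sorries; standard axioms except the `ℤ²` upper half, which
inherits the declared `native_decide` certificate `FiniteMemory.checkW_16_2_1` from X26.
-/

noncomputable section

open Finset Filter Topology Literature.Probability.LatticeModels
open Literature.Probability.RandomPlanarGeometry.SAW
open scoped BigOperators

namespace Literature.Probability.RandomPlanarGeometry.SAW.Zd

/-- `c_N ≤ c_1^N` (submultiplicativity).
[cite: MadrasSlade1993, Lemma 1.2.2 (Fekete); Beaton2015, §3] -/
theorem count_le_count_one_pow (d N : ℕ) : (Zd.count (d + 1) N : ℝ) ≤ (Zd.count (d + 1) 1 : ℝ) ^ N := by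
  induction N with
  | zero => simp [Zd.count_zero]
  | succ n ih =>
    calc (Zd.count (d + 1) (n + 1) : ℝ) ≤ (Zd.count (d + 1) n : ℝ) * Zd.count (d + 1) 1 := by
          exact_mod_cast Zd.count_add_le (d + 1) n 1
      _ ≤ (Zd.count (d + 1) 1 : ℝ) ^ n * Zd.count (d + 1) 1 :=
          mul_le_mul_of_nonneg_right ih (Nat.cast_nonneg _)
      _ = (Zd.count (d + 1) 1 : ℝ) ^ (n + 1) := by rw [pow_succ]

/-- Crude exponential upper bound: `Z^B_N(y) ≤ (c_1 · max(1,y))^N`.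
[cite: MadrasSlade1993, Lemma 1.2.2 (Fekete); Beaton2015, §3] -/
theorem pulledBridgeZ_le_pow (d N : ℕ) {y : ℝ} (hy : 0 < y) :
    pulledBridgeZ (d + 1) N y ≤ ((Zd.count (d + 1) 1 : ℝ) * max 1 y) ^ N := by
  classical
  rw [pulledBridgeZ_eq_sum_bridges]
  have hterm : ∀ ω ∈ Zd.bridges (d + 1) N, y ^ (ω N 0).toNat ≤ (max 1 y) ^ N := by
    intro ω hω
    have hsp : (ω N 0).toNat ≤ N := by
      have := span_le_of_mem_bridges hω
      omega
    calc y ^ (ω N 0).toNat ≤ (max 1 y) ^ (ω N 0).toNat :=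
          pow_le_pow_left₀ hy.le (le_max_right _ _) _
      _ ≤ (max 1 y) ^ N := pow_le_pow_right₀ (le_max_left _ _) hsp
  have hsub : Zd.bridges (d + 1) N ⊆ Zd.saws (d + 1) N := fun ω hω => (Zd.mem_bridges.1 hω).1
  calc ∑ ω ∈ Zd.bridges (d + 1) N, y ^ (ω N 0).toNat
      ≤ ∑ _ω ∈ Zd.bridges (d + 1) N, (max 1 y) ^ N := Finset.sum_le_sum hterm
    _ = (Zd.bridges (d + 1) N).card * (max 1 y) ^ N := by rw [Finset.sum_const, nsmul_eq_mul]
    _ ≤ (Zd.count (d + 1) N : ℝ) * (max 1 y) ^ N := by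
        refine mul_le_mul_of_nonneg_right ?_ (by positivity)
        rw [← Zd.card_saws]; exact_mod_cast Finset.card_le_card hsub
    _ ≤ (Zd.count (d + 1) 1 : ℝ) ^ N * (max 1 y) ^ N :=
        mul_le_mul_of_nonneg_right (count_le_count_one_pow d N) (by positivity)
    _ = ((Zd.count (d + 1) 1 : ℝ) * max 1 y) ^ N := by rw [mul_pow]

/-- **PROVED — the pulled-bridge free energy exists** (Fekete on `-log Z^B_N(y)`, subadditive by
`pulledBridgeZ_mul_le`, bounded below by `pulledBridgeZ_le_pow`): for every `y > 0` there is `λ` with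
`N⁻¹ log Z^B_N(y) → λ` and `N⁻¹ log Z^B_N(y) ≤ λ` for every `N ≥ 1` (`λ = sup_N N⁻¹ log Z^B_N(y)`).
[cite: MadrasSlade1993, Lemma 1.2.2 (Fekete); Beaton2015, §3] -/
theorem exists_tendsto_log_pulledBridgeZ_div (d : ℕ) {y : ℝ} (hy : 0 < y) :
    ∃ lam : ℝ, Tendsto (fun N : ℕ => Real.log (pulledBridgeZ (d + 1) N y) / N) atTop (𝓝 lam) ∧
      ∀ N : ℕ, 1 ≤ N → Real.log (pulledBridgeZ (d + 1) N y) / N ≤ lam := by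
  set u : ℕ → ℝ := fun N => -Real.log (pulledBridgeZ (d + 1) N y) with hu_def
  have hpos := fun N => pulledBridgeZ_pos d N hy
  have hu : Subadditive u := by
    intro m n
    simp only [hu_def]
    have hlog := Real.log_le_log (mul_pos (hpos m) (hpos n)) (pulledBridgeZ_mul_le d m n hy.le)
    rw [Real.log_mul (hpos m).ne' (hpos n).ne'] at hlog
    linarith
  have hK1 : (1 : ℝ) ≤ (Zd.count (d + 1) 1 : ℝ) * max 1 y := by
    have h1 : (1 : ℝ) ≤ Zd.count (d + 1) 1 := by exact_mod_cast Zd.one_le_count (d + 1) 1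
    calc (1 : ℝ) = 1 * 1 := (mul_one 1).symm
      _ ≤ (Zd.count (d + 1) 1 : ℝ) * max 1 y := mul_le_mul h1 (le_max_left _ _) zero_le_one (by linarith)
  have hK : (0 : ℝ) < (Zd.count (d + 1) 1 : ℝ) * max 1 y := by linarith
  have hbdd : BddBelow (Set.range fun n : ℕ => u n / n) := by
    refine ⟨-Real.log ((Zd.count (d + 1) 1 : ℝ) * max 1 y), ?_⟩
    rintro _ ⟨n, rfl⟩
    rcases Nat.eq_zero_or_pos n with rfl | hn
    · simp only [Nat.cast_zero, div_zero, Left.neg_nonpos_iff]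
      exact Real.log_nonneg hK1
    · have hlog := Real.log_le_log (hpos n) (pulledBridgeZ_le_pow d n hy)
      rw [Real.log_pow] at hlog
      simp only [hu_def]
      rw [le_div_iff₀ (by exact_mod_cast hn : (0 : ℝ) < n)]
      linarith
  refine ⟨-hu.lim, ?_, ?_⟩
  · exact (hu.tendsto_lim hbdd).neg.congr fun n => by simp [hu_def, neg_div]
  · intro N hN
    have := hu.lim_le_div hbdd (show N ≠ 0 by omega)
    simp only [hu_def, neg_div] at this
    linarith

/-- `λ_B(y)`, the pulled-bridge free energy (the limit; characterised by `tendsto_pulledBridgeFreeEnergy`).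
[cite: MadrasSlade1993, Lemma 1.2.2 (Fekete); Beaton2015, §3] -/
def pulledBridgeFreeEnergy (d : ℕ) [NeZero d] (y : ℝ) : ℝ :=
  limUnder atTop fun N : ℕ => Real.log (pulledBridgeZ d N y) / N

/-- `N⁻¹ log Z^B_N(y) → λ_B(y)` for `y > 0`.
[cite: MadrasSlade1993, Lemma 1.2.2 (Fekete); Beaton2015, §3] -/
theorem tendsto_pulledBridgeFreeEnergy (d : ℕ) {y : ℝ} (hy : 0 < y) :
    Tendsto (fun N : ℕ => Real.log (pulledBridgeZ (d + 1) N y) / N) atTop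
      (𝓝 (pulledBridgeFreeEnergy (d + 1) y)) := by
  obtain ⟨lam, hlam, -⟩ := exists_tendsto_log_pulledBridgeZ_div d hy
  exact tendsto_nhds_limUnder ⟨lam, hlam⟩

/-- `λ_B(y) = sup`: every single length bounds the free energy from below, `N⁻¹ log Z^B_N(y) ≤ λ_B(y)`.
[cite: MadrasSlade1993, Lemma 1.2.2 (Fekete); Beaton2015, §3] -/
theorem log_div_le_pulledBridgeFreeEnergy (d : ℕ) {y : ℝ} (hy : 0 < y) {N : ℕ} (hN : 1 ≤ N) :
    Real.log (pulledBridgeZ (d + 1) N y) / N ≤ pulledBridgeFreeEnergy (d + 1) y := by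
  obtain ⟨lam, hlam, hle⟩ := exists_tendsto_log_pulledBridgeZ_div d hy
  rw [tendsto_nhds_unique (tendsto_pulledBridgeFreeEnergy d hy) hlam]
  exact hle N hN

/-- Transfer of a geometric LOWER bound: `C ρ^N ≤ Z^B_N(y)` for all `N` ⇒ `log ρ ≤ λ_B(y)`.
[cite: MadrasSlade1993, Lemma 1.2.2 (Fekete); Beaton2015, §3] -/
theorem log_le_pulledBridgeFreeEnergy_of_geometric (d : ℕ) {y C ρ : ℝ} (hy : 0 < y) (hC : 0 < C)
    (hρ : 0 < ρ) (h : ∀ N : ℕ, C * ρ ^ N ≤ pulledBridgeZ (d + 1) N y) :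
    Real.log ρ ≤ pulledBridgeFreeEnergy (d + 1) y := by
  have ht := tendsto_pulledBridgeFreeEnergy d hy
  have hlow : Tendsto (fun N : ℕ => Real.log C / N + Real.log ρ) atTop (𝓝 (0 + Real.log ρ)) :=
    (tendsto_const_div_atTop_nhds_zero_nat (Real.log C)).add tendsto_const_nhds
  rw [zero_add] at hlow
  refine le_of_tendsto_of_tendsto hlow ht (Filter.eventually_atTop.2 ⟨1, fun N hN => ?_⟩)
  have hN0 : (0 : ℝ) < N := by exact_mod_cast hN
  have hlog := Real.log_le_log (by positivity) (h N)
  rw [Real.log_mul hC.ne' (pow_pos hρ N).ne', Real.log_pow] at hlog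
  show Real.log C / N + Real.log ρ ≤ Real.log (pulledBridgeZ (d + 1) N y) / N
  rw [div_add' _ _ _ hN0.ne', div_le_div_iff_of_pos_right hN0]
  linarith

/-- Transfer of a geometric UPPER bound: `Z^B_N(y) ≤ C K^N` for all `N` ⇒ `λ_B(y) ≤ log K`.
[cite: MadrasSlade1993, Lemma 1.2.2 (Fekete); Beaton2015, §3] -/
theorem pulledBridgeFreeEnergy_le_log_of_geometric (d : ℕ) {y C K : ℝ} (hy : 0 < y) (hC : 0 < C)
    (hK : 0 < K) (h : ∀ N : ℕ, pulledBridgeZ (d + 1) N y ≤ C * K ^ N) :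
    pulledBridgeFreeEnergy (d + 1) y ≤ Real.log K := by
  have ht := tendsto_pulledBridgeFreeEnergy d hy
  have hupp : Tendsto (fun N : ℕ => Real.log C / N + Real.log K) atTop (𝓝 (0 + Real.log K)) :=
    (tendsto_const_div_atTop_nhds_zero_nat (Real.log C)).add tendsto_const_nhds
  rw [zero_add] at hupp
  refine le_of_tendsto_of_tendsto ht hupp (Filter.eventually_atTop.2 ⟨1, fun N hN => ?_⟩)
  have hN0 : (0 : ℝ) < N := by exact_mod_cast hN
  have hlog := Real.log_le_log (pulledBridgeZ_pos d N hy) (h N)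
  rw [Real.log_mul hC.ne' (pow_pos hK N).ne', Real.log_pow] at hlog
  show Real.log (pulledBridgeZ (d + 1) N y) / N ≤ Real.log C / N + Real.log K
  rw [div_add' _ _ _ hN0.ne', div_le_div_iff_of_pos_right hN0]
  linarith

/-- **X27 as a free-energy statement** (every `d`, every `y > 1`): `λ_B(y) ≥ log(μ + e^{-2/(y-1)}) > log μ`.
[cite: MadrasSlade1993, Lemma 1.2.2 (Fekete); Beaton2015, §3] -/
theorem log_connectiveConstant_add_exp_le_pulledBridgeFreeEnergy (d : ℕ) {y : ℝ} (hy : 1 < y) :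
    Real.log (Zd.connectiveConstant (d + 1) + Real.exp (-(2 / (y - 1)))) ≤ pulledBridgeFreeEnergy (d + 1) y := by
  have hμ := Zd.connectiveConstant_pos (d + 1)
  have hKpos : 0 < Zd.connectiveConstant (d + 1) + Real.exp (-(2 / (y - 1))) := by positivity
  refine le_of_forall_lt_imp_le_of_dense fun c hc => ?_
  have hρ : Real.exp c < Zd.connectiveConstant (d + 1) + Real.exp (-(2 / (y - 1))) := by
    rwa [← Real.lt_log_iff_exp_lt hKpos]
  obtain ⟨C, hC, hCN⟩ := pulledBridgeZ_geometric_lower d hy (Real.exp_pos c) hρ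
  have := log_le_pulledBridgeFreeEnergy_of_geometric d (by linarith) hC (Real.exp_pos c) hCN
  rwa [Real.log_exp] at this


/-- **X26 «PULL-ENCL» (K1 edition) as a free-energy statement on `ℤ²`**: `log(1250/351) ≤ λ_B(2) ≤ log(7206013/2000000)`
(`e^{λ_B(2)} ∈ [3.5612…, 3.6030065]`; lower half: tilted Kraft span-1 family, standard axioms; upper half: the
`native_decide` certificate `checkW_16_2_1` via `SAW.driftZ_two_upper` and `Z^B ≤ Z`).
[cite: Beaton2015, Theorem 1; GuttmannJensenWhittington2013, Table 1 (numerical context)] -/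
theorem pulledBridgeFreeEnergy_two_two_mem :
    Real.log (1250 / 351) ≤ pulledBridgeFreeEnergy 2 2 ∧
      pulledBridgeFreeEnergy 2 2 ≤ Real.log (7206013 / 2000000) := by
  obtain ⟨κ, hκ, hlow⟩ := pulledBridgeZ_two_lower
  refine ⟨log_le_pulledBridgeFreeEnergy_of_geometric 1 (by norm_num) hκ (by norm_num) hlow,
    pulledBridgeFreeEnergy_le_log_of_geometric 1 (y := 2) (C := 2 ^ 41) (by norm_num) (by norm_num)
      (by norm_num) fun N => ?_⟩
  calc pulledBridgeZ (1 + 1) N 2 ≤ driftZ 2 N (Real.log 2) := pulledBridgeZ_le_driftZ 2 N (by norm_num)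
    _ ≤ 2 ^ 41 * (7206013 / 2000000 : ℝ) ^ N := driftZ_two_upper N

end Literature.Probability.RandomPlanarGeometry.SAW.Zd
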